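import Summits.BirchSwinnertonDyer.Rank1Residual.X5.TwoAdicTargets
import Summits.BirchSwinnertonDyer.Rank1Residual.X11b.BDPRoute
import Literature.NumberTheory.EllipticCurves.BSDShaProofs
import HarnessLib

/-!
# Class O1 (X5, `p = 2`, non-CM): the o1 class lead's targets T0 / T1⁻ / T5 in tree currency
# (companion of `X5/TwoAdicTargets.lean`)

HONEST FRAMING (cell `b2b-bsdres`, run/shared/lean/b2b/bsd-rank1-residual/, verbatim in every
file): the goal of the cell is to DELETE the COMBINATION-SHAPED residual classes of the
Birch–Swinnerton-Dyer formula for ALL analytic-rank `≤ 1` elliptic curves over `ℚ` — "full BSD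
formula for every rank `≤ 1` curve in class `C`" assembled STRICTLY from published theorems — so
that the rank-`≤ 1` remainder becomes exactly the CONSTRUCTION-SHAPED classes, which are TYPED
(missing-input `Prop`s), NOT attempted. This is not "finishing BSD". Research routes; no claim
beyond stated classes; census output = EVIDENCE / conjecture items, never a Literature fact;
nothing here is booked; no mark of RESIDUAL-MAP §I moves.

Unit `b2b-bsdres-cc-typer-4` (lane CLASS-CLOSURE, class O1, seat cc-typer-4), gen 1, second file:
the targets T0 / T1⁻ / T5 of the o1 class lead's `HOME/cells/o1/PLAN.md` v1 §3 (2026-08-21T04:53Z;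
indicative names `X5.shaAn_two_adic_val_even`, `X5.upperBoundAt_two_of_bigImage`,
`X5.rankOne_two_part_of_heegnerIndex`), typed against the predicates of `X5/TwoAdicTargets.lean`
(p249352: `O1.TwoAdicSurjective`, the reduction cells, `O1.MainConjectureLowerDivisibilityAtTwo`, …)
and the refuter's acceptance points (`HOME/cells/o1/REFUTER-O1.md` v1.2 §3b: slack explicit, no
"Λ-integral by [Kato]" claim, the real place carried by the tree's Selmer groups). T2 of the PLAN is
the existing `MazurMainConjecture W 2` (+ the lower half `O1.MainConjectureLowerDivisibilityAtTwo`);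
T3/T4 are packaged as `O1.TwoAdicEulerCharRankZero W δ`; T6 is `O1.TwistTransportAtTwo` (statement)
— see `HOME/class-closure/O1/TYPING.md` for the cross-walk and the counts.

Contents: T0 `O1.ShaAnTwoAdicValEven` (`@[conjecture]`) with `shaAnTwoAdicValEven_of_bsdp`
(PROVED: BSD(E,2) + Cassels–Tate + GZK ⇒ T0); T1⁻ `O1.UpperBoundAtTwoOfBigImage W δ`
(`@[conjecture]`, Kato-side half on O1-A with slack `δ`) with `upperBoundAtTwoOfBigImage_zero_iff`
and the slack-0 assembly `bsdp_two_of_upperBound_zero_of_lowerBound` (PROVED bookkeeping); T5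
`O1.RankOneIndexIdentityAtTwo W K P δ` (`@[conjecture]`, = `X11b.IndexIdentityAt W 2 K P` at slack
0: `rankOneIndexIdentityAtTwo_zero_iff`). DEFINITIONS (`@[conjecture]` obligations) + bookkeeping
theorems only; NO named fact.

References: [Miller2011LMS] Def. 1.1; [SilvermanAEC2009] Thm. X.4.14; [Wuthrich2014] Prop. 21;
[Kato2004Asterisque] Thm. 14.5 (3); [GrossLMS1991] §2 (2.2); [Castella2018] (5.3); [KrizLi2019] Thm. 5.1.
-/

noncomputable section

open scoped Classical MatrixGroups ModularForm

open CongruenceSubgroup WeierstrassCurve Literature.NumberTheory.EllipticCurves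
  Literature.NumberTheory.EllipticCurves.ModularForms Literature.NumberTheory.EllipticCurves.Rank1Residual
  Literature.NumberTheory.EllipticCurves.Rank1Residual.Typed
  Summit.BirchSwinnertonDyer.BirchSwinnertonDyer.Theorems.Rank1ResidualX1Defs

set_option autoImplicit false

namespace Summit.BirchSwinnertonDyer.Rank1Residual.X5.O1

variable (W : WeierstrassCurve ℚ) [W.IsElliptic] [W.IsGloballyMinimal]

/-! ## The o1 lead's targets T0 / T1⁻ / T5 (cells/o1/PLAN.md v1 §3) in tree currency -/

/-- **T0 (o1 lead) — the parity skeleton of `BSD(E,2)`: `ord₂ #Ш_an` is a non-negative EVEN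
integer** for every non-CM `E/ℚ` of analytic rank `≤ 1` (`#Ш_an` rational). NOT a theorem:
Cassels–Tate makes `#Ш[2^∞]` a square (tree: `isSquare_shaOrder_of_casselsTate`), but evenness of
the `2`-adic valuation of the ANALYTIC order is a statement about `L`-values and follows only from
`BSD(E,2)` itself (`shaAnTwoAdicValEven_of_bsdp` below). EVIDENCE: `v₂(#Ш_an) ∈ {0,2,4,6,8}` on all
1 876 304 classes of analytic rank `≤ 1` with `N < 5·10⁵` (rmap-3 g5 / refuter §3b: no curve of
record can refute it; a refutation needs a certified odd `v₂(#Ш_an)` — anomaly-protocol territory).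
The census invariant every E1 fit must respect. OPEN; nothing asserted.
[cite: Miller2011LMS, Def. 1.1 (BSD(E,2)) with Cassels 1962/1965 (#Ш[2^∞] a square) — consequence shape only] -/
@[conjecture] def ShaAnTwoAdicValEven : Prop :=
  W.analyticRank ≤ 1 → ¬ W.HasCM →
    ∃ q : ℚ, shaAn W = (q : ℂ) ∧ 0 ≤ padicValRat 2 q ∧ Even (padicValRat 2 q)

omit [W.IsGloballyMinimal] in
/-- T0 follows from `BSD(E,2)` granted Cassels–Tate (`bsd.S18`, `exists_casselsTate_pairing`) and
GZK (finiteness of `Ш` at analytic rank `≤ 1`): `ord₂ #Ш_an = ord₂ #Ш(2) = ord₂ #Ш`, and `#Ш` is a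
square. (So T0 is exactly as strong as "BSD(E,2) modulo its square root", not weaker in kind.)
[cite: SilvermanAEC2009, Thm. X.4.14 (Cassels–Tate ⇒ #Ш square)] [cite: Miller2011LMS, Def. 1.1] -/
theorem shaAnTwoAdicValEven_of_bsdp (hCT : exists_casselsTate_pairing (K := ℚ))
    (hGZK : rank_eq_analyticRank_of_analyticRank_le_one) (hr : W.analyticRank ≤ 1)
    (h : BSDp W 2) : ShaAnTwoAdicValEven W := by
  intro _ _
  haveI : Finite W.sha := (hGZK W hr).2
  obtain ⟨-, -, q, hq, hv⟩ := h
  rw [padicValNat_card_addPrimaryComponent] at hv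
  obtain ⟨m, hm⟩ := isSquare_shaOrder_of_casselsTate hCT W (show W.ShaFinite from ‹Finite W.sha›)
  have hm0 : m ≠ 0 := by
    intro h0
    have hpos := shaOrder_pos W (show W.ShaFinite from ‹Finite W.sha›)
    rw [hm, h0, mul_zero] at hpos
    exact lt_irrefl 0 hpos
  have hsha : padicValNat 2 (Nat.card W.sha) = padicValNat 2 m + padicValNat 2 m := by
    change padicValNat 2 W.shaOrder = _
    rw [hm, padicValNat.mul hm0 hm0]
  refine ⟨q, hq, ?_, ?_⟩
  · rw [hv]; exact_mod_cast Nat.zero_le _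
  · rw [hv, hsha]; exact ⟨(padicValNat 2 m : ℤ), by push_cast; ring⟩

/-- **T1⁻ (o1 lead: `X5.upperBoundAt_two_of_bigImage`) — the Kato-side HALF of `BSD(E,2)` on
sub-class O1-A with the census slack `δ₂`**: for non-CM `E` of analytic rank `0`, good ordinary or
multiplicative at `2`, with `ρ_{E,2^∞}` surjective (`TwoAdicSurjective`, the (12.5.2)-at-2
condition): `ord₂ #Ш ≤ ord₂ #Ш_an + δ`. `δ = 0` is `MissingUpperBoundAt W 2` on O1-A
(`upperBoundAtTwoOfBigImage_zero_iff`). Closest print: Kato Thm. 14.5 (3) / Wuthrich 2014 Prop. 21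
at ODD `p` (rank `0`, surjective or Borel image); at `2` NOT in print (refuter F2/F3: the `p ≠ 2`
clauses sit in the Euler-system-to-Selmer step and the `±`-splitting, not in an image condition).
Route: `KatoDivisibilityAtTwoUpTo W k f` + `TwoAdicEulerCharRankZero W δ'` ⇒ this with `δ = k + δ'`
on O1-go (the multiplicative cells need the Tate-curve `2`-adic `L`, not typed at `2`). E1 fits `δ`;
refuter's crux K_ES(2): success criterion `δ ≤ 1`. COUNT: (goodOrd ∨ mult) ∧ surj(8) ∧ r = 0 =
2 055 of the 5 275 r0 cells (typer's anatomy, 2026-08-21). OPEN; nothing asserted.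
[cite: Wuthrich2014, Prop. 21 (odd p; shape only)] [cite: Kato2004Asterisque, Thm. 14.5 (3) (p ≠ 2; shape only)] -/
@[conjecture] def UpperBoundAtTwoOfBigImage (δ : ℕ) : Prop :=
  ¬ W.HasCM → W.analyticRank = 0 → (GoodOrd W 2 ∨ Mult W 2) → TwoAdicSurjective W →
    ∃ q : ℚ, shaAn W = (q : ℂ) ∧ (padicValNat 2 W.shaOrder : ℤ) ≤ padicValRat 2 q + δ

omit [W.IsElliptic] in
/-- At slack `δ = 0`, T1⁻ is the tree's `MissingUpperBoundAt W 2` on sub-class O1-A. Bookkeeping.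
[cite: Miller2011LMS, Def. 1.1] -/
theorem upperBoundAtTwoOfBigImage_zero_iff :
    UpperBoundAtTwoOfBigImage W 0 ↔
      (¬ W.HasCM → W.analyticRank = 0 → (GoodOrd W 2 ∨ Mult W 2) → TwoAdicSurjective W →
        MissingUpperBoundAt W 2) := by
  unfold UpperBoundAtTwoOfBigImage MissingUpperBoundAt
  simp only [Nat.cast_zero, add_zero]

/-- **Assembly on O1-A at slack `0`**: the Kato-side half (T1⁻ at `δ = 0`) and the Eisenstein-side
half (`MissingLowerBoundAt W 2`, the irreducible residue) give `BSD(E,2)` in analytic rank `0`,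
granted GZK. Pure bookkeeping over `Typed/Basic` (`missingPPartAt_of_lower_of_upper`,
`bsdp_of_missingPPartAt`). [cite: Miller2011LMS, §1 and Def. 1.1] -/
theorem bsdp_two_of_upperBound_zero_of_lowerBound
    (hGZK : rank_eq_analyticRank_of_analyticRank_le_one) (hcm : ¬ W.HasCM)
    (hr : W.analyticRank = 0) (hred : GoodOrd W 2 ∨ Mult W 2) (him : TwoAdicSurjective W)
    (hup : UpperBoundAtTwoOfBigImage W 0) (hlow : MissingLowerBoundAt W 2) : BSDp W 2 :=
  bsdp_of_missingPPartAt W 2 hGZK (by omega)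
    (missingPPartAt_of_lower_of_upper W 2 hlow
      ((upperBoundAtTwoOfBigImage_zero_iff W).1 hup hcm hr hred him))

/-- **T5 (o1 lead: `X5.rankOne_two_part_of_heegnerIndex`) — the Heegner-index identity over `K`
AT `2` with the census slack `δ`**: for a number field `K` (an imaginary quadratic field in which
every `ℓ ∣ N` splits, in every use) and a point `P ∈ E(K)` (the Heegner point of a parametrisation,
in every use): `2·ord₂ ∏_ℓ c_ℓ(E/ℚ) + ord₂ #Ш(E/K) + δ = 2·ord₂ [E(K) : ℤ·P]`. `δ = 0` is VERBATIM the
x11b cell's `p`-generic `X11b.IndexIdentityAt W 2 K P` (Gross–Zagier V (2.2) / Gross 1991 (2.2) /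
Castella 2018 (5.3) read at `p = 2`; `rankOneIndexIdentityAtTwo_zero_iff`); at `2` the printed
identity carries the Manin constant, `u_K = #𝒪_K^×/2` and `#E(K)_tors` `2`-parts that are units at
the odd primes of the x11b uses — the census (Heegner-index engines ×2 at `2` on the 20 r = 1 cells
and on closed r = 1 classes) fits `δ`. Closest print at `2`: Kriz–Li 2019 Thm. 5.1 (`E(ℚ)[2] = 0`,
`c₂` odd, (★)) — first sub-cell; Kolyvagin's bound at `2` carries an unspecified power of `2`
(GJPST 2009 Thm. 3.4: "p is an odd prime"). Descent `K → ℚ` at `2` = the E3-BC comparison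
(TYPING.md §3). OPEN; nothing asserted.
[cite: GrossLMS1991, §2 Conj. (2.2) (shape; p = 2 normalisation open)] [cite: KrizLi2019, Thm. 5.1 (first sub-cell at 2)] -/
@[conjecture] def RankOneIndexIdentityAtTwo (K : Type) [Field K] [NumberField K]
    (P : (W.baseChange K).toAffine.Point) (δ : ℤ) : Prop :=
  (2 * padicValNat 2 W.tamagawaProduct + padicValNat 2 (W.baseChange K).shaOrder : ℤ) + δ =
    2 * padicValNat 2 (AddSubgroup.zmultiples P).index

omit [W.IsElliptic] [W.IsGloballyMinimal] in
/-- At slack `0`, T5 is the x11b cell's `IndexIdentityAt` read at `p = 2`. Bookkeeping.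
[cite: Castella2018, (5.3) (p. 12)] -/
theorem rankOneIndexIdentityAtTwo_zero_iff (K : Type) [Field K] [NumberField K]
    (P : (W.baseChange K).toAffine.Point) :
    RankOneIndexIdentityAtTwo W K P 0 ↔ X11b.IndexIdentityAt W 2 K P := by
  unfold RankOneIndexIdentityAtTwo X11b.IndexIdentityAt
  simp only [add_zero]
  constructor
  · intro h; exact_mod_cast h
  · intro h; exact_mod_cast h

end Summit.BirchSwinnertonDyer.Rank1Residual.X5.O1

end
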